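import Summits.QuantumFields.YangMills.Theorems.LangevinControlUVOSLegsAtWeakCouplingCStubClusterFrame
import Summits.QuantumFields.YangMills.Theorems.MirrorModularBoostsHypercubicLimitClosureHalvesDefs
import Summits.QuantumFields.YangMills.Theorems.LangevinControlUVOSLegsAtWeakCouplingCDefs
import Literature.MathematicalPhysics.QuantumFieldTheory.SchwingerLimitInheritance
import Literature.MathematicalPhysics.QuantumLattice.SchwartzTranslationCutoff
import HarnessLib

/-!
# Crux `WeakCouplingHypercubicLimit` (stmt-QuantumFields-16120), line `Sketch`, r10 wave 2: the reflected–shifted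
tensor test function (sub-goal SG-I/J `reflectedTensor_facts`)

Helper file of the lead (c4) for the r10 skeleton `Cruxes/WeakCouplingHypercubicLimit/Lines/Sketch.lean`.  The lattice
reflection-positivity and clustering identities of the skeleton are evaluated on the test functions
`Θ(τ_d F)* ⊗ T_v F'`: the OS adjoint (`osAdjoint`) of `F` with slot `l` shifted by a vector `d l`
(`SchwartzMap.compSubConstCLM ℂ d F`, `w ↦ F (w - d)`), tensored (`SchwartzMap.appendTensor`) with a translate
`translateMulti v F'` of `F'`.

* (I) **off-diagonality**: if `F` is supported at `δ`-separated configurations (`Separated n δ`) with all times `≥ τ`,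
  `F'` at positive-time, pairwise distinct configurations, and `‖d l‖ ≤ a` with `2a < δ`, `a < τ`, then
  `Θ(τ_d F)* ⊗ F' ∈ ⁰𝒮`: its support misses the coincidence locus, since the first block of arguments carries times
  `≤ a − τ < 0` and pairwise distances `≥ δ − 2a > 0`, the second block positive times and pairwise distinct points
  (as in `isOffDiagonal_appendTensor_osAdjoint_of_posSep` of `…OSLegsAtWeakCouplingCStubClusterFrame`);
* (J) **continuity**: `Θ(τ_{d k} F)* ⊗ T_{v k} F' → ΘF* ⊗ T_{v₀} F'` in `𝓢` when `d k → 0` and `v k → v₀` (joint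
  continuity of `⊗` — `SchwartzMap.tendsto_appendTensor` —, continuity of `Θ(·)*` and strong continuity of the
  translation group on `𝓢`, `continuous_compSubConstCLM` / `continuous_translateMulti`).

Refs: OsterwalderSchraderCMP1973 §2, §4.1; GlimmJaffe1987 §6.1; Hörmander I §7.1.
-/

noncomputable section

open scoped SchwartzMap BigOperators ComplexConjugate
open MeasureTheory Filter Topology
open Literature.MathematicalPhysics.QuantumFieldTheory Literature.MathematicalPhysics.QuantumLattice
open Literature.MathematicalPhysics.AQFT
open Literature.Probability.LatticeModels (box Site)
open Summit.QuantumFields.YangMills.Cruxes.HypercubicLimit.CouplingResponse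
open Summit.QuantumFields.YangMills.Cruxes.OSLegsFromFemtoAndGap.DlrCollarTransfer (plane conn Decay RPPos ConnCS)
open Summit.QuantumFields.YangMills.Cruxes.OSLegsAtWeakCouplingC.Sketch (Separated)
open Summit.QuantumFields.YangMills.Theorems.OSLegsFromFemtoAndGap

namespace Summit.QuantumFields.YangMills.Theorems.WeakCouplingHypercubicLimit.TraceNormColdPressure

/-- The support of the shifted test function `w ↦ G (w - ℓ)` is the shifted support: `w - ℓ ∈ tsupport G` for every
`w` in the support of `SchwartzMap.compSubConstCLM ℂ ℓ G`. [folklore] -/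
theorem tsupport_compSubConstCLM_subset_preimage_sub {X : Type*} [NormedAddCommGroup X] [NormedSpace ℝ X] (ℓ : X)
    (G : 𝓢(X, ℂ)) :
    tsupport ((SchwartzMap.compSubConstCLM ℂ ℓ G : 𝓢(X, ℂ)) : X → ℂ) ⊆ (fun y => y - ℓ) ⁻¹' tsupport (G : X → ℂ) := by
  refine closure_minimal (fun y hy => ?_) ((isClosed_tsupport _).preimage (continuous_id.sub continuous_const))
  exact subset_tsupport _ hy

/-- **Registered sub-goal `reflectedTensor_facts` (SG-I/J, line `Sketch`, r10 wave 2): the reflected–shifted tensor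
test function `Θ(τ_d F)* ⊗ T_v F'` of the lattice pairing.**
(I) It is off-diagonal when `F` is supported at `δ`-separated configurations with times `≥ τ > 0`, `F'` at
positive-time pairwise distinct configurations, and the slot shifts have norms `≤ a` with `2a < δ`, `a < τ`.
(J) It converges in `𝓢` to `ΘF* ⊗ T_{v₀} F'` as the shifts tend to `0` and the translation vectors to `v₀`. [folklore] -/
theorem reflectedTensor_facts :
    (∀ (n n' : ℕ) (F : 𝓢((Fin n → EuclideanSpace ℝ (Fin 4)), ℂ)) (F' : 𝓢((Fin n' → EuclideanSpace ℝ (Fin 4)), ℂ))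
      (δ τ a : ℝ) (d : Fin n → EuclideanSpace ℝ (Fin 4)), 0 < τ →
      tsupport (F : (Fin n → EuclideanSpace ℝ (Fin 4)) → ℂ) ⊆ Separated n δ →
      tsupport (F : (Fin n → EuclideanSpace ℝ (Fin 4)) → ℂ) ⊆ {u | ∀ l, τ ≤ u l 0} →
      tsupport (F' : (Fin n' → EuclideanSpace ℝ (Fin 4)) → ℂ) ⊆ {v | (∀ l, 0 < v l 0) ∧ Function.Injective v} →
      (∀ l, ‖d l‖ ≤ a) → 2 * a < δ → a < τ →
      IsOffDiagonal ((osAdjoint (SchwartzMap.compSubConstCLM ℂ d F)).appendTensor F')) ∧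
    (∀ (n n' : ℕ) (F : 𝓢((Fin n → EuclideanSpace ℝ (Fin 4)), ℂ)) (F' : 𝓢((Fin n' → EuclideanSpace ℝ (Fin 4)), ℂ))
      (d : ℕ → Fin n → EuclideanSpace ℝ (Fin 4)) (v : ℕ → EuclideanSpace ℝ (Fin 4)) (v₀ : EuclideanSpace ℝ (Fin 4)),
      Tendsto d atTop (𝓝 0) → Tendsto v atTop (𝓝 v₀) →
      Tendsto (fun k => (osAdjoint (SchwartzMap.compSubConstCLM ℂ (d k) F)).appendTensor (translateMulti (v k) F'))
        atTop (𝓝 ((osAdjoint F).appendTensor (translateMulti v₀ F')))) := by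
  refine ⟨fun n n' F F' δ τ a d _hτ hsep htime hF' hd h2a haτ => ?_, fun n n' F F' d v v₀ hd hv => ?_⟩
  · -- (I): the support of `Θ(τ_d F)* ⊗ F'` misses the coincidence locus.
    refine IsOffDiagonal.of_tsupport_subset fun x hx => ?_
    obtain ⟨hA, hB⟩ := OSReconstructionNoE1.tsupport_appendTensor_subset _ _ hx
    -- the reflected, reversed first block, minus the shifts, lies in the support of `F`
    have hw : (fun i => timeReflection 4 (x (Fin.castAdd n' (Fin.rev i)))) - d ∈
        tsupport (F : (Fin n → EuclideanSpace ℝ (Fin 4)) → ℂ) :=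
      tsupport_compSubConstCLM_subset_preimage_sub d F
        (OSReconstructionNoE1.tsupport_osAdjoint_subset (SchwartzMap.compSubConstCLM ℂ d F) hA)
    have hsepw : ∀ i j, i ≠ j → δ ≤ dist (((fun i => timeReflection 4 (x (Fin.castAdd n' (Fin.rev i)))) - d) i)
        (((fun i => timeReflection 4 (x (Fin.castAdd n' (Fin.rev i)))) - d) j) := hsep hw
    have htw : ∀ l, τ ≤ ((fun i => timeReflection 4 (x (Fin.castAdd n' (Fin.rev i)))) - d) l 0 := htime hw
    obtain ⟨hposQ, hinjQ⟩ := hF' hB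
    -- the time components of the shifts are at most `a` in absolute value
    have hd0 : ∀ l, |d l 0| ≤ a := fun l => by
      have h := PiLp.norm_apply_le (d l) 0
      rw [Real.norm_eq_abs] at h
      exact h.trans (hd l)
    -- the first block carries negative times
    have hneg : ∀ i, x (Fin.castAdd n' i) 0 < 0 := fun i => by
      have h := htw (Fin.rev i)
      simp only [Pi.sub_apply, PiLp.sub_apply, Fin.rev_rev, OSReconstructionNoE1.timeReflection_apply_zero] at h
      have h' := (abs_le.1 (hd0 (Fin.rev i))).1
      linarith
    rw [← Fin.append_castAdd_natAdd (f := x)]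
    refine not_mem_coincidenceLocus_of_injective (Fin.append_injective_iff.2 ⟨?_, hinjQ, ?_⟩)
    · -- first block: coincident points would put two shifted support points at distance `≤ 2a < δ`
      intro i j hij
      by_contra hne
      have hij' : x (Fin.castAdd n' i) = x (Fin.castAdd n' j) := hij
      have h := hsepw (Fin.rev i) (Fin.rev j) fun h => hne (Fin.rev_injective h)
      simp only [Pi.sub_apply, Fin.rev_rev, hij', dist_sub_left] at h
      linarith [dist_le_norm_add_norm (d (Fin.rev i)) (d (Fin.rev j)), hd (Fin.rev i), hd (Fin.rev j)]
    · -- cross terms: negative versus positive times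
      intro i j hij
      have h0 := congrArg (fun v : EuclideanSpace ℝ (Fin 4) => v 0) hij
      simp only at h0
      linarith [hneg i, hposQ j]
  · -- (J): joint continuity of `⊗`, continuity of `Θ(·)*`, strong continuity of translations on `𝓢`.
    have h1 : Tendsto (fun k => SchwartzMap.compSubConstCLM ℂ (d k) F) atTop (𝓝 F) := by
      have h := ((continuous_compSubConstCLM ℂ F).tendsto 0).comp hd
      rwa [SchwartzMap.compSubConstCLM_zero, ContinuousLinearMap.id_apply] at h
    have h2 : Tendsto (fun k => osAdjoint (SchwartzMap.compSubConstCLM ℂ (d k) F)) atTop (𝓝 (osAdjoint F)) :=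
      (continuous_osAdjoint.tendsto F).comp h1
    have h3 : Tendsto (fun k => translateMulti (v k) F') atTop (𝓝 (translateMulti v₀ F')) :=
      ((continuous_translateMulti F').tendsto v₀).comp hv
    exact SchwartzMap.tendsto_appendTensor h2 h3

end Summit.QuantumFields.YangMills.Theorems.WeakCouplingHypercubicLimit.TraceNormColdPressure

end
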